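import Mathlib.Analysis.InnerProductSpace.TensorProduct
import Mathlib.Analysis.Complex.Isometry
import Mathlib.RingTheory.TensorProduct.Maps
import Mathlib.Algebra.Algebra.Prod
import Mathlib.LinearAlgebra.Dimension.Constructions
import Mathlib.LinearAlgebra.FiniteDimensional.Lemmas
import Mathlib.LinearAlgebra.Complex.FiniteDimensional
import HarnessLib

/-!
# [IUTchIV] Proposition 1.5 (i), (ii) (Archimedean Metric Estimates): `ℂ ⊗_ℝ ℂ ⥲ ℂ ⊕ ℂ` versus metrics,
# and the primitive automorphisms

Mochizuki, *Inter-universal Teichmüller theory IV*, RIMS manuscript (Apr. 2020; = PRIMS **57** (2021)),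
§1, Proposition 1.5, pp. 14–15 (classical and undisputed content; the bibliographic key of the series
carries the D-0012 claim status, hence the tag form). Printed proof (p. 16): "Assertions (i) and (ii) are
discussed in [IUTchIII], Remark 3.9.1, (ii), and may be verified by means of routine and elementary
arguments." This file supplies those arguments, with REAL definitions:

* the "complex archimedean field `ℂ` … equipped with its standard Hermitian metric" is Mathlib's `ℂ` as a
  real inner product space (`⟪w, z⟫_ℝ = Re(z·w̄)`, `‖z‖² = |z|²`); "the tensor product metric on `ℂ ⊗_ℝ ℂ`"
  is Mathlib's inner product on the tensor product (`TensorProduct.instInnerProductSpace`: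
  `⟪a ⊗ b, c ⊗ d⟫ = ⟪a, c⟫·⟪b, d⟫`); the "direct sum metric on `ℂ ⊕ ℂ`" is `|a|² + |b|²` on `ℂ × ℂ`;
* the "isomorphism of topological rings [i.e., arising from the Chinese remainder theorem]
  `ℂ ⊗_ℝ ℂ ⥲ ℂ ⊕ ℂ`" is `crt : ℂ ⊗[ℝ] ℂ →ₐ[ℝ] ℂ × ℂ`, `z ⊗ w ↦ (z·w, z·w̄)` (an `ℝ`-algebra homomorphism,
  proved bijective: `crtEquiv`);
* "the primitive automorphisms of `ℂ`": "the group of automorphisms [of order 8] of the underlying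
  metrized real vector space of `ℂ` generated by … complex conjugation and multiplication by `±1` or
  `±√−1`" — these are in particular `ℝ`-linear isometries of `ℂ`, and we prove (ii) for ALL pairs of
  `ℝ`-linear isometries `σ, τ` of `ℂ` (each is `z ↦ u·z` or `z ↦ u·z̄`, `|u| = 1`, Mathlib
  `linear_isometry_complex`), which contains the printed statement.

PROVED: (i) `norm_sq_crt` — "the metric on the right-hand side corresponds to 2 times the metric on the
left-hand side [Thus, lengths differ by a factor of `√2`]": `|pr₁(crt t)|² + |pr₂(crt t)|² = 2·‖t‖²` for
every `t ∈ ℂ ⊗_ℝ ℂ` (via the polarized identity `inner_crt`), and `crt` is an isomorphism (`crtEquiv`);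
(ii) `directSum_preserved` — for `ℝ`-linear isometries `σ, τ` of `ℂ`, the automorphism `σ ⊗ τ` of
`ℂ ⊗_ℝ ℂ`, transported along `crt`, maps the two direct summands to direct summands (identically or by
the swap) through `ℝ`-linear isometries of `ℂ`, hence preserves "the direct sum decomposition `ℂ ⊕ ℂ`,
together with its Hermitian metric" (`directSum_norm_preserved`).

Deliberately NOT here: (iii), (iv) (tensor products of several copies `M_I = ⊗_{i∈I} ⊕_{v∈V} ℂ_v`, the
`2^{|I|−1}·|V|^{|I|}` copies and the integral structure `B_I`) — they iterate (i), (ii) and are typed in a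
separate file; the group-theoretic statement "of order 8".
-/

noncomputable section

namespace Literature.IUT.LogVolume

namespace Prop15

open scoped TensorProduct ComplexConjugate
open Complex

/-! ## The CRT isomorphism `ℂ ⊗_ℝ ℂ → ℂ ⊕ ℂ` -/

/-- The Chinese-remainder map `ℂ ⊗_ℝ ℂ → ℂ × ℂ`, `z ⊗ w ↦ (z·w, z·w̄)`, as an `ℝ`-algebra homomorphism
("any isomorphism of topological rings [i.e., arising from the Chinese remainder theorem]
`ℂ ⊗_ℝ ℂ ⥲ ℂ ⊕ ℂ`", Prop. 1.5 (i), p. 15). [claim: Mochizuki2012, status: disputed] -/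
def crt : ℂ ⊗[ℝ] ℂ →ₐ[ℝ] ℂ × ℂ :=
  Algebra.TensorProduct.lift ((AlgHom.id ℝ ℂ).prod (AlgHom.id ℝ ℂ))
    ((AlgHom.id ℝ ℂ).prod Complex.conjAe.toAlgHom) (fun _ _ => Commute.all _ _)

/-- `crt (z ⊗ w) = (z·w, z·w̄)`. [claim: Mochizuki2012, status: disputed] -/
@[simp] theorem crt_tmul (z w : ℂ) : crt (z ⊗ₜ[ℝ] w) = (z * w, z * conj w) := by
  unfold crt
  rw [Algebra.TensorProduct.lift_tmul]
  rfl

/-- The key pointwise identity behind (i): `Re(cd·\overline{ab}) + Re(c d̄·\overline{a b̄}) =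
2·Re(c ā)·Re(d b̄)`. [folklore] -/
private theorem re_identity (a b c d : ℂ) :
    (c * d * conj (a * b)).re + (c * conj d * conj (a * conj b)).re =
      2 * ((c * conj a).re * (d * conj b).re) := by
  simp only [mul_re, mul_im, conj_re, conj_im, map_mul, Complex.conj_conj]
  ring

/-- **Prop. 1.5 (i), polarized form**: for all `s, t ∈ ℂ ⊗_ℝ ℂ`,
`⟪pr₁ crt s, pr₁ crt t⟫ + ⟪pr₂ crt s, pr₂ crt t⟫ = 2·⟪s, t⟫` (direct sum metric vs tensor product metric).
[claim: Mochizuki2012, status: disputed] -/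
theorem inner_crt (s t : ℂ ⊗[ℝ] ℂ) :
    inner ℝ (crt s).1 (crt t).1 + inner ℝ (crt s).2 (crt t).2 = 2 * inner ℝ s t := by
  induction s using TensorProduct.induction_on generalizing t with
  | zero => simp
  | tmul a b =>
    induction t using TensorProduct.induction_on with
    | zero => simp
    | tmul c d =>
      rw [crt_tmul, crt_tmul, TensorProduct.inner_tmul]
      simp only [Complex.inner]
      exact re_identity a b c d
    | add x y hx hy =>
      rw [map_add, Prod.fst_add, Prod.snd_add, inner_add_right, inner_add_right, inner_add_right]
      linarith
  | add x y hx hy =>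
    rw [map_add, Prod.fst_add, Prod.snd_add, inner_add_left, inner_add_left, inner_add_left]
    linarith [hx t, hy t]

/-- **[IUTchIV] Prop. 1.5 (i) (Direct Sum vs. Tensor Product Metrics)**: "relative to these metrics,
[the CRT isomorphism] is compatible with these metrics, up to a factor of 2, i.e., the metric on the
right-hand side corresponds to 2 times the metric on the left-hand side. [Thus, lengths differ by a factor
of `√2`.]" — `|pr₁ crt t|² + |pr₂ crt t|² = 2·‖t‖²`. [claim: Mochizuki2012, status: disputed] -/
theorem norm_sq_crt (t : ℂ ⊗[ℝ] ℂ) : ‖(crt t).1‖ ^ 2 + ‖(crt t).2‖ ^ 2 = 2 * ‖t‖ ^ 2 := by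
  have h := inner_crt t t
  rw [real_inner_self_eq_norm_sq, real_inner_self_eq_norm_sq,
    show inner ℝ t t = ‖t‖ ^ 2 from real_inner_self_eq_norm_sq t] at h
  exact h

/-- `crt` is injective (immediate from (i): `crt t = 0 ⟹ ‖t‖ = 0`). [claim: Mochizuki2012, status: disputed] -/
theorem crt_injective : Function.Injective crt := by
  rw [injective_iff_map_eq_zero]
  intro t ht
  have h := norm_sq_crt t
  rw [ht, Prod.fst_zero, Prod.snd_zero, norm_zero] at h
  have : ‖t‖ ^ 2 = 0 := by nlinarith
  exact norm_eq_zero.mp (by nlinarith [norm_nonneg t, sq_nonneg ‖t‖, this])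

/-- `crt` is bijective (`dim_ℝ ℂ ⊗_ℝ ℂ = 4 = dim_ℝ ℂ ⊕ ℂ`). [claim: Mochizuki2012, status: disputed] -/
theorem crt_bijective : Function.Bijective crt := by
  have hfin : Module.finrank ℝ (ℂ ⊗[ℝ] ℂ) = Module.finrank ℝ (ℂ × ℂ) := by
    rw [Module.finrank_tensorProduct, Module.finrank_prod, Complex.finrank_real_complex]
  refine ⟨crt_injective, ?_⟩
  exact (LinearMap.injective_iff_surjective_of_finrank_eq_finrank hfin (f := crt.toLinearMap)).mp
    crt_injective

/-- The CRT isomorphism of `ℝ`-algebras `ℂ ⊗_ℝ ℂ ≃ ℂ × ℂ` ("any isomorphism of topological rings [i.e.,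
arising from the Chinese remainder theorem]", p. 15). [claim: Mochizuki2012, status: disputed] -/
def crtEquiv : ℂ ⊗[ℝ] ℂ ≃ₐ[ℝ] ℂ × ℂ := AlgEquiv.ofBijective crt crt_bijective

/-- `crtEquiv` is `crt`. [claim: Mochizuki2012, status: disputed] -/
@[simp] theorem crtEquiv_apply (t : ℂ ⊗[ℝ] ℂ) : crtEquiv t = crt t := rfl

/-! ## (ii): automorphisms induced by isometries of the two factors -/

/-- An `ℝ`-linear isometry `σ` of `ℂ` is `z ↦ u·z` or `z ↦ u·z̄` with `|u| = 1` (Mathlib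
`linear_isometry_complex`); the primitive automorphisms (`conj`, `±1`, `±√−1` and their products) are
among these. For such `σ, τ` we use the induced automorphism `σ ⊗ τ` of `ℂ ⊗_ℝ ℂ`
(`TensorProduct.map`). [claim: Mochizuki2012, status: disputed] -/
def induced (σ τ : ℂ ≃ₗᵢ[ℝ] ℂ) : ℂ ⊗[ℝ] ℂ →ₗ[ℝ] ℂ ⊗[ℝ] ℂ :=
  TensorProduct.map σ.toLinearEquiv.toLinearMap τ.toLinearEquiv.toLinearMap

/-- `induced σ τ (z ⊗ w) = σ z ⊗ τ w`. [claim: Mochizuki2012, status: disputed] -/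
@[simp] theorem induced_tmul (σ τ : ℂ ≃ₗᵢ[ℝ] ℂ) (z w : ℂ) :
    induced σ τ (z ⊗ₜ[ℝ] w) = σ z ⊗ₜ[ℝ] τ w := rfl

/-- Multiplication by a unit complex number `u` followed, optionally, by nothing: the `ℝ`-linear isometry
`x ↦ u·x` of `ℂ` (`|u| = 1`). [folklore] -/
private def mulIso (u : Circle) : ℂ ≃ₗᵢ[ℝ] ℂ := rotation u

/-- The `ℝ`-linear isometry `x ↦ u·x̄` of `ℂ` (`|u| = 1`). [folklore] -/
private def mulConjIso (u : Circle) : ℂ ≃ₗᵢ[ℝ] ℂ := conjLIE.trans (rotation u)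

/-- `mulIso u x = u·x`. [folklore] -/
private theorem mulIso_apply (u : Circle) (x : ℂ) : mulIso u x = u * x := rotation_apply u x

/-- `mulConjIso u x = u·x̄`. [folklore] -/
private theorem mulConjIso_apply (u : Circle) (x : ℂ) : mulConjIso u x = u * conj x := by
  simp [mulConjIso, rotation_apply, conjLIE_apply]

/-- "Preserves the direct sum decomposition `ℂ ⊕ ℂ`, together with its Hermitian metric": a linear
endomorphism `g` of `ℂ ⊗_ℝ ℂ` such that, transported along `crt`, it maps the summands to summands —
identically or by the swap — through `ℝ`-linear isometries `u₁, u₂` of `ℂ`. [claim: Mochizuki2012, status: disputed] -/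
def PreservesDirectSum (g : ℂ ⊗[ℝ] ℂ →ₗ[ℝ] ℂ ⊗[ℝ] ℂ) : Prop :=
  ∃ u₁ u₂ : ℂ ≃ₗᵢ[ℝ] ℂ,
    (∀ t, crt (g t) = (u₁ (crt t).1, u₂ (crt t).2)) ∨ (∀ t, crt (g t) = (u₁ (crt t).2, u₂ (crt t).1))

/-- Two `ℝ`-linear maps `ℂ ⊗_ℝ ℂ → ℂ × ℂ` that agree on pure tensors agree. [folklore] -/
private theorem ext_tmul {f g : ℂ ⊗[ℝ] ℂ →ₗ[ℝ] ℂ × ℂ} (h : ∀ z w : ℂ, f (z ⊗ₜ w) = g (z ⊗ₜ w)) :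
    f = g :=
  TensorProduct.ext' h

/-- The map `t ↦ (u₁ (crt t).i, u₂ (crt t).j)` as an `ℝ`-linear map (`i, j` = the two projections, in
either order). [folklore] -/
private def transported (u₁ u₂ : ℂ ≃ₗᵢ[ℝ] ℂ) (swap : Bool) : ℂ ⊗[ℝ] ℂ →ₗ[ℝ] ℂ × ℂ :=
  if swap then
    (u₁.toLinearEquiv.toLinearMap.comp ((LinearMap.snd ℝ ℂ ℂ).comp crt.toLinearMap)).prod
      (u₂.toLinearEquiv.toLinearMap.comp ((LinearMap.fst ℝ ℂ ℂ).comp crt.toLinearMap))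
  else
    (u₁.toLinearEquiv.toLinearMap.comp ((LinearMap.fst ℝ ℂ ℂ).comp crt.toLinearMap)).prod
      (u₂.toLinearEquiv.toLinearMap.comp ((LinearMap.snd ℝ ℂ ℂ).comp crt.toLinearMap))

/-- Unfolding `transported … false`. [folklore] -/
private theorem transported_false (u₁ u₂ : ℂ ≃ₗᵢ[ℝ] ℂ) (t : ℂ ⊗[ℝ] ℂ) :
    transported u₁ u₂ false t = (u₁ (crt t).1, u₂ (crt t).2) := by
  simp [transported]

/-- Unfolding `transported … true`. [folklore] -/
private theorem transported_true (u₁ u₂ : ℂ ≃ₗᵢ[ℝ] ℂ) (t : ℂ ⊗[ℝ] ℂ) :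
    transported u₁ u₂ true t = (u₁ (crt t).2, u₂ (crt t).1) := by
  simp [transported]

/-- **[IUTchIV] Prop. 1.5 (ii) (Direct Sum vs. Tensor Product Automorphisms)**: "the direct sum
decomposition `ℂ ⊕ ℂ`, together with its Hermitian metric, is preserved, relative to the displayed
isomorphism of (i), by the automorphisms of `ℂ ⊗_ℝ ℂ` induced by the various primitive automorphisms of
the two copies of “`ℂ`” that appear in the tensor product `ℂ ⊗_ℝ ℂ`" — proved for all `ℝ`-linear
isometries `σ, τ` of `ℂ` (rotations act summand-wise, reflections `z ↦ u·z̄` swap the summands).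
[claim: Mochizuki2012, status: disputed] -/
theorem directSum_preserved (σ τ : ℂ ≃ₗᵢ[ℝ] ℂ) : PreservesDirectSum (induced σ τ) := by
  obtain ⟨a, ha | ha⟩ := linear_isometry_complex σ <;>
    obtain ⟨b, hb | hb⟩ := linear_isometry_complex τ
  · -- `σ z = a z`, `τ w = b w`: no swap, `u₁ = ab·`, `u₂ = a b̄·`
    refine ⟨mulIso (a * b), mulIso (a * b⁻¹), Or.inl fun t => ?_⟩
    have := congrArg (fun f => f t)
      (ext_tmul (f := crt.toLinearMap.comp (induced σ τ))
        (g := transported (mulIso (a * b)) (mulIso (a * b⁻¹)) false) (fun z w => ?_))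
    · simpa [transported_false] using this
    · simp only [LinearMap.comp_apply, AlgHom.toLinearMap_apply, induced_tmul, transported_false,
        crt_tmul, ha, hb, mulIso_apply, rotation_apply, Circle.coe_mul, Circle.coe_inv_eq_conj]
      refine Prod.ext ?_ ?_ <;> simp only [map_mul] <;> ring_nf
  · -- `σ z = a z`, `τ w = b w̄`: swap
    refine ⟨mulIso (a * b), mulIso (a * b⁻¹), Or.inr fun t => ?_⟩
    have := congrArg (fun f => f t)
      (ext_tmul (f := crt.toLinearMap.comp (induced σ τ))
        (g := transported (mulIso (a * b)) (mulIso (a * b⁻¹)) true) (fun z w => ?_))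
    · simpa [transported_true] using this
    · simp only [LinearMap.comp_apply, AlgHom.toLinearMap_apply, induced_tmul, transported_true,
        crt_tmul, ha, hb, mulIso_apply, LinearIsometryEquiv.trans_apply, conjLIE_apply,
        rotation_apply]
      refine Prod.ext ?_ ?_ <;> simp only [map_mul, Complex.conj_conj, Circle.coe_mul,
        Circle.coe_inv_eq_conj] <;> ring_nf
  · -- `σ z = a z̄`, `τ w = b w`: swap, with conjugation
    refine ⟨mulConjIso (a * b), mulConjIso (a * b⁻¹), Or.inr fun t => ?_⟩
    have := congrArg (fun f => f t)
      (ext_tmul (f := crt.toLinearMap.comp (induced σ τ))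
        (g := transported (mulConjIso (a * b)) (mulConjIso (a * b⁻¹)) true) (fun z w => ?_))
    · simpa [transported_true] using this
    · simp only [LinearMap.comp_apply, AlgHom.toLinearMap_apply, induced_tmul, transported_true,
        crt_tmul, ha, hb, mulConjIso_apply, LinearIsometryEquiv.trans_apply, conjLIE_apply,
        rotation_apply]
      refine Prod.ext ?_ ?_ <;> simp only [map_mul, Complex.conj_conj, Circle.coe_mul,
        Circle.coe_inv_eq_conj] <;> ring_nf
  · -- both conjugate: no swap, with conjugation
    refine ⟨mulConjIso (a * b), mulConjIso (a * b⁻¹), Or.inl fun t => ?_⟩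
    have := congrArg (fun f => f t)
      (ext_tmul (f := crt.toLinearMap.comp (induced σ τ))
        (g := transported (mulConjIso (a * b)) (mulConjIso (a * b⁻¹)) false) (fun z w => ?_))
    · simpa [transported_false] using this
    · simp only [LinearMap.comp_apply, AlgHom.toLinearMap_apply, induced_tmul, transported_false,
        crt_tmul, ha, hb, mulConjIso_apply, LinearIsometryEquiv.trans_apply, conjLIE_apply,
        rotation_apply]
      refine Prod.ext ?_ ?_ <;> simp only [map_mul, Complex.conj_conj, Circle.coe_mul,
        Circle.coe_inv_eq_conj] <;> ring_nf

/-- Consequence for the Hermitian (direct sum) metric: an endomorphism preserving the direct sum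
decomposition through isometries preserves `|a|² + |b|²`. [claim: Mochizuki2012, status: disputed] -/
theorem directSum_norm_preserved {g : ℂ ⊗[ℝ] ℂ →ₗ[ℝ] ℂ ⊗[ℝ] ℂ} (hg : PreservesDirectSum g)
    (t : ℂ ⊗[ℝ] ℂ) :
    ‖(crt (g t)).1‖ ^ 2 + ‖(crt (g t)).2‖ ^ 2 = ‖(crt t).1‖ ^ 2 + ‖(crt t).2‖ ^ 2 := by
  obtain ⟨u₁, u₂, h | h⟩ := hg
  · rw [h t]; simp only [LinearIsometryEquiv.norm_map]
  · rw [h t]; simp only [LinearIsometryEquiv.norm_map]; ring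

/-- In particular the induced automorphisms are isometries of the tensor product metric as well (by (i)).
[claim: Mochizuki2012, status: disputed] -/
theorem induced_norm (σ τ : ℂ ≃ₗᵢ[ℝ] ℂ) (t : ℂ ⊗[ℝ] ℂ) : ‖induced σ τ t‖ = ‖t‖ := by
  have h1 := norm_sq_crt (induced σ τ t)
  have h2 := norm_sq_crt t
  have h3 := directSum_norm_preserved (directSum_preserved σ τ) t
  have : ‖induced σ τ t‖ ^ 2 = ‖t‖ ^ 2 := by linarith
  exact (pow_left_inj₀ (norm_nonneg _) (norm_nonneg _) two_ne_zero).mp this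

end Prop15

end Literature.IUT.LogVolume

end
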